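import Summits.Ventures.GridStability.Models.InverterPLL

/-!
# GridStability/Models/InverterPLLClosedLoop — the SRF-PLL closed against an infinite bus through the printed quasi-static q-axis relation: the solved loop, and the kernel DICTIONARY to the generalized swing equation (rung G3.d, MODELLED column)

Cell `gridfusion` (LADDER-GRIDFUSION, apex-line rung G3.d «PLL-swing»; seat gridfusion-model-3 (g7);
models/MODEL-3-NOTES.md §0 row «GFL converter, SRF-PLL block» and §1 (P6)).

WHAT IS COMPOSED HERE (flagged COMPOSED, as `InverterPLL.vgqComposed` already is). The type-2 SRF-PLL
AS PRINTED [cite: HenriquezAuba2022, eqs. (2.61a)–(2.61c)] (`θ̇ = Ω_b (ω_pll − ω_s)`, `ε̇ = v_q`,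
`ω_pll = ω* + k^p v_q + k^i ε`; `Models/InverterPLL.lean` §1) is closed against an infinite bus by the
printed quasi-static q-axis relation [cite: Qoria2020, eq. (II-20)] solved for the PCC voltage
(`QAxisQuasiStatic.vgq_eq`: `v_q = v_{e,q} + R_g i_q + ω_g L_g i_d`) with `v_{e,q} = −V_e sin θ`
(`veqOf`, dq convention (II-36)–(II-37)), CONSTANT current references `i_d, i_q` (fast current loops,
[cite: Qoria2020, §II.3.1]) and the frame frequency `ω_g := ω_pll` (the PCC quantities are measured
in the PLL frame). The last substitution closes an AFFINE loop `v_q ↦ ω_pll ↦ v_q`; for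
`μ := 1 − k^p L_g i_d ≠ 0` it has the unique solution `vqSolved` (§1: `vqSolved_fixed`,
`vqSolved_unique`). The closed reduced model is `IsClosedLoopSolution` (states `θ`, `ε`).

THE DICTIONARY (kernel identities about the typed objects; the printed reduced form is
[cite: MaEtAl2022], not held — its dimensionless normalisation [cite: DuEtAl2024, Eq. (1)] is the typed
`GenSwing`). §2 `hasDerivAt_freqMismatch`: along every closed-loop solution the frequency mismatch
`x := ω_pll − ω_s` obeys, with `θ̇ = Ω_b x`,
`μ ẋ = k^i (R_g i_q + ω_s L_g i_d − V_e sin θ) − (k^p V_e Ω_b cos θ − k^i L_g i_d) x`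
— a swing equation with STATE-DEPENDENT damping `k^p V_e Ω_b cos θ − k^i L_g i_d`: the proportional
gain supplies the `cos θ`-damping, and the product (integral gain) × (grid inductance) × (active
current reference) is the CONSTANT ANTI-DAMPING. §3 `genSwingOf` / `isSolution_genSwingOf`: for
`μ > 0`, `k^i V_e > 0`, `Ω_b > 0` the time/frequency rescaling `τ = σ t`, `ω = Ω_b x/σ`,
`σ = √(k^i V_e Ω_b/μ)` carries every closed-loop solution to a solution of `GenSwing ⟨I, D, α⟩` with
`I = (R_g i_q + ω_s L_g i_d)/V_e`, `D = k^i L_g i_d/(μ σ)`, `α = k^p V_e Ω_b/(μ σ)` — so every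
kernel sentence about `GenSwing` (G3.d certificate and -roa, the divergence/outer-strip theorems) is a
sentence about the SRF-PLL gains and the grid branch; in particular `D > 0 ⟺ k^i L_g i_d > 0` (given
`μ, σ > 0`): injecting active current (`i_d > 0`) through an inductive branch is what creates the
anti-damping of Eq. (1).

THREE COLUMNS. Everything here is MODELLED + COMPOSED: balanced fundamental-frequency phasors,
quasi-static branch (line dynamics neglected), algebraic current loops, no PLL input filter /
normalisation / limiter, `ω_g := ω_pll` in (II-20) (MODEL-VALIDITY MV-INV-3, MV-6P). No sentence of
this file says a converter or a grid is stable; no parameter values (model-4 custody).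
-/

noncomputable section

open Real

namespace Summit.Ventures.GridStability.Models.InverterPLL

/-- Data of the quasi-static closure [cite: Qoria2020, eq. (II-20) and §II.3.1]: infinite-bus voltage
magnitude `V_e`, grid branch `R_g`, `L_g` (pu), and the CONSTANT current references `i_d`, `i_q`
delivered by the fast current loops (MODELLED: algebraic current control). -/
structure PccBranch where
  /-- infinite-bus voltage magnitude `V_e` -/
  Ve : ℝ
  /-- grid-branch resistance `R_g` -/
  Rg : ℝ
  /-- grid-branch inductance `L_g` (pu reactance at base frequency) -/
  Lg : ℝ
  /-- d-axis (active) current reference `i_d` -/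
  igd : ℝ
  /-- q-axis (reactive) current reference `i_q` -/
  igq : ℝ

namespace SrfPll

variable (L : SrfPll) (B : PccBranch)

/-! ## §1 The affine loop `v_q ↦ ω_pll ↦ v_q` and its solution -/

/-- Loop factor `μ = 1 − k^p L_g i_d` of the affine loop
`v_q = −V_e sin θ + R_g i_q + ω_pll L_g i_d`, `ω_pll = ω* + k^p v_q + k^i ε` (COMPOSED). -/
def loopFactor : ℝ := 1 - L.kp * B.Lg * B.igd

/-- The solved PCC q-axis voltage
`v_q(θ, ε) = (−V_e sin θ + R_g i_q + L_g i_d (ω* + k^i ε)) / μ` (COMPOSED; `μ ≠ 0`). -/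
def vqSolved (θ ε : ℝ) : ℝ :=
  (-(B.Ve * sin θ) + B.Rg * B.igq + B.Lg * B.igd * (L.ωref + L.ki * ε)) / L.loopFactor B

/-- `vqSolved` SOLVES the loop: it equals the composed q-voltage `vgqComposed` evaluated at the PLL
frequency it itself produces (`ω_g := ω_pll`). -/
theorem vqSolved_fixed (hμ : L.loopFactor B ≠ 0) (θ ε : ℝ) :
    L.vqSolved B θ ε
      = vgqComposed B.Ve B.Rg B.Lg (L.omegaPll (L.vqSolved B θ ε) ε) B.igd B.igq θ := by
  have hq : L.vqSolved B θ ε * L.loopFactor B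
      = -(B.Ve * sin θ) + B.Rg * B.igq + B.Lg * B.igd * (L.ωref + L.ki * ε) :=
    div_mul_cancel₀ _ hμ
  simp only [loopFactor] at hq
  simp only [vgqComposed, veqOf, omegaPll]
  linear_combination hq

/-- Uniqueness: any q-voltage consistent with the loop is `vqSolved` (`μ ≠ 0`). -/
theorem vqSolved_unique (hμ : L.loopFactor B ≠ 0) {θ ε vq : ℝ}
    (h : vq = vgqComposed B.Ve B.Rg B.Lg (L.omegaPll vq ε) B.igd B.igq θ) :
    vq = L.vqSolved B θ ε := by
  have hμ' : 1 - L.kp * B.Lg * B.igd ≠ 0 := hμ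
  simp only [vgqComposed, veqOf, omegaPll] at h
  have hlin : (1 - L.kp * B.Lg * B.igd) * vq
      = -(B.Ve * sin θ) + B.Rg * B.igq + B.Lg * B.igd * (L.ωref + L.ki * ε) := by
    linear_combination h
  simp only [vqSolved, loopFactor]
  rw [eq_div_iff hμ']
  linear_combination hlin

/-- PLL frequency along the solved loop: `μ ω_pll = ω* + k^p (R_g i_q − V_e sin θ) + k^i ε`. -/
theorem loopFactor_mul_omegaPll (hμ : L.loopFactor B ≠ 0) (θ ε : ℝ) :
    L.loopFactor B * L.omegaPll (L.vqSolved B θ ε) ε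
      = L.ωref + L.kp * (B.Rg * B.igq - B.Ve * sin θ) + L.ki * ε := by
  have hμ' : 1 - L.kp * B.Lg * B.igd ≠ 0 := hμ
  simp only [vqSolved, omegaPll, loopFactor]
  field_simp
  ring

/-- A classical solution of the COMPOSED closed loop: SRF-PLL (2.61a)–(2.61c) driven by the solved
quasi-static q-voltage `vqSolved` (states: PLL-frame angle `θ` w.r.t. the bus, integrator `ε`).
[cite: HenriquezAuba2022, eqs. (2.61a)–(2.61c)] (PLL block) + [cite: Qoria2020, eq. (II-20)] (closure,
COMPOSED with `ω_g := ω_pll`). -/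
structure IsClosedLoopSolution (θ ε : ℝ → ℝ) : Prop where
  /-- `θ̇ = Ω_b (ω_pll − ω_s)` with `ω_pll = ω* + k^p v_q + k^i ε`, `v_q = vqSolved` -/
  angle : ∀ t, HasDerivAt θ (L.dθ (L.vqSolved B (θ t) (ε t)) (ε t)) t
  /-- `ε̇ = v_q = vqSolved` -/
  integ : ∀ t, HasDerivAt ε (L.dε (L.vqSolved B (θ t) (ε t))) t

/-- Frequency mismatch `x = ω_pll − ω_s` [pu] as a function of the closed-loop state. -/
def freqMismatch (θ ε : ℝ) : ℝ := L.omegaPll (L.vqSolved B θ ε) ε - L.ωs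

/-! ## §2 The closed loop IS a generalized swing equation (dimensional form) -/

/-- Angle equation in mismatch form: `θ̇ = Ω_b x`. -/
theorem hasDerivAt_angle {θ ε : ℝ → ℝ} (h : L.IsClosedLoopSolution B θ ε) (t : ℝ) :
    HasDerivAt θ (L.Ωb * L.freqMismatch B (θ t) (ε t)) t := by
  simpa [dθ, freqMismatch] using h.angle t

/-- **The COMPOSED SRF-PLL closed loop is a swing equation with state-dependent damping.** Along
every closed-loop solution, with `x = ω_pll − ω_s` and `μ = 1 − k^p L_g i_d ≠ 0`,
`ẋ = (k^i (R_g i_q + ω_s L_g i_d − V_e sin θ) − (k^p V_e Ω_b cos θ − k^i L_g i_d) x) / μ`: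
restoring torque `k^i V_e sin θ`, `cos θ`-DAMPING from the proportional gain, CONSTANT ANTI-DAMPING
`k^i L_g i_d` from active current through the grid inductance (the structure of
[cite: DuEtAl2024, Eq. (1)], after [cite: MaEtAl2022]). -/
theorem hasDerivAt_freqMismatch (hμ : L.loopFactor B ≠ 0) {θ ε : ℝ → ℝ}
    (h : L.IsClosedLoopSolution B θ ε) (t : ℝ) :
    HasDerivAt (fun τ => L.freqMismatch B (θ τ) (ε τ))
      ((L.ki * (B.Rg * B.igq + L.ωs * B.Lg * B.igd - B.Ve * sin (θ t))
        - (L.kp * B.Ve * L.Ωb * cos (θ t) - L.ki * B.Lg * B.igd) * L.freqMismatch B (θ t) (ε t))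
        / L.loopFactor B) t := by
  have hμ' : 1 - L.kp * B.Lg * B.igd ≠ 0 := hμ
  have hθ := h.angle t
  have hε := h.integ t
  -- closed form of the mismatch: x = (ω* + k^p (R_g i_q − V_e sin θ) + k^i ε)/μ − ω_s
  have hform : (fun τ => L.freqMismatch B (θ τ) (ε τ))
      = fun τ => (L.ωref + L.kp * (B.Rg * B.igq - B.Ve * sin (θ τ)) + L.ki * ε τ)
          / L.loopFactor B - L.ωs := by
    funext τ
    have := L.loopFactor_mul_omegaPll B hμ (θ τ) (ε τ)
    simp only [freqMismatch]
    field_simp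
    linarith
  rw [hform]
  -- differentiate the closed form
  have h1 : HasDerivAt (fun τ => B.Ve * sin (θ τ))
      (B.Ve * (cos (θ t) * L.dθ (L.vqSolved B (θ t) (ε t)) (ε t))) t := hθ.sin.const_mul _
  have h2 : HasDerivAt (fun τ => L.ωref + L.kp * (B.Rg * B.igq - B.Ve * sin (θ τ)) + L.ki * ε τ)
      (L.kp * (0 - B.Ve * (cos (θ t) * L.dθ (L.vqSolved B (θ t) (ε t)) (ε t)))
        + L.ki * L.dε (L.vqSolved B (θ t) (ε t))) t := by
    have ha := ((hasDerivAt_const t (B.Rg * B.igq)).sub h1).const_mul L.kp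
    have hb := hε.const_mul L.ki
    have := (ha.add hb).const_add L.ωref
    simpa [add_assoc] using this
  have h3 := (h2.div_const (L.loopFactor B)).sub_const L.ωs
  -- identify the derivative
  have hx : L.freqMismatch B (θ t) (ε t)
      = (L.ωref + L.kp * (B.Rg * B.igq - B.Ve * sin (θ t)) + L.ki * ε t) / L.loopFactor B - L.ωs := by
    have := congrArg (fun f => f t) hform
    simpa using this
  have hv : L.vqSolved B (θ t) (ε t)
      = -(B.Ve * sin (θ t)) + B.Rg * B.igq + L.ωs * B.Lg * B.igd
          + B.Lg * B.igd * L.freqMismatch B (θ t) (ε t) := by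
    have hfix := L.vqSolved_fixed B hμ (θ t) (ε t)
    nth_rewrite 1 [hfix]
    simp only [vgqComposed, veqOf, freqMismatch]
    ring
  have he : (L.kp * (0 - B.Ve * (cos (θ t) * L.dθ (L.vqSolved B (θ t) (ε t)) (ε t)))
        + L.ki * L.dε (L.vqSolved B (θ t) (ε t))) / L.loopFactor B
      = (L.ki * (B.Rg * B.igq + L.ωs * B.Lg * B.igd - B.Ve * sin (θ t))
        - (L.kp * B.Ve * L.Ωb * cos (θ t) - L.ki * B.Lg * B.igd) * L.freqMismatch B (θ t) (ε t))
        / L.loopFactor B := by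
    have hd : L.dθ (L.vqSolved B (θ t) (ε t)) (ε t) = L.Ωb * L.freqMismatch B (θ t) (ε t) := by
      simp [dθ, freqMismatch]
    rw [hd, dε, hv]
    ring
  rw [he] at h3
  exact h3

/-! ## §3 Rescaling to the dimensionless `GenSwing` -/

/-- Dimensionless input power `I = (R_g i_q + ω_s L_g i_d)/V_e` (equilibria: `sin θ* = I`). -/
def dimI : ℝ := (B.Rg * B.igq + L.ωs * B.Lg * B.igd) / B.Ve

/-- Time-scale factor `σ = √(k^i V_e Ω_b / μ)` (natural frequency of the PLL swing equation). -/
def sigma : ℝ := Real.sqrt (L.ki * B.Ve * L.Ωb / L.loopFactor B)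

/-- Dimensionless CONSTANT anti-damping `D = k^i L_g i_d/(μ σ)` of [cite: DuEtAl2024, Eq. (1)]. -/
def dimD : ℝ := L.ki * B.Lg * B.igd / (L.loopFactor B * L.sigma B)

/-- Dimensionless state-dependent damping coefficient `α = k^p V_e Ω_b/(μ σ)` of Eq. (1). -/
def dimAlpha : ℝ := L.kp * B.Ve * L.Ωb / (L.loopFactor B * L.sigma B)

/-- The generalized swing equation `⟨I, D, α⟩` the composed closed loop rescales to. -/
def genSwingOf : GenSwing where
  I := L.dimI B
  D := L.dimD B
  α := L.dimAlpha B

/-- `σ² = k^i V_e Ω_b/μ` when the radicand is positive. -/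
theorem sigma_sq (hpos : 0 < L.ki * B.Ve * L.Ωb / L.loopFactor B) :
    L.sigma B ^ 2 = L.ki * B.Ve * L.Ωb / L.loopFactor B := by
  unfold sigma
  rw [Real.sq_sqrt hpos.le]

/-- `σ > 0` when the radicand is positive. -/
theorem sigma_pos (hpos : 0 < L.ki * B.Ve * L.Ωb / L.loopFactor B) : 0 < L.sigma B :=
  Real.sqrt_pos.2 hpos

/-- Sign dictionary: for `μ > 0` and `σ > 0`, the anti-damping `D` of Eq. (1) is positive EXACTLY
when `k^i L_g i_d > 0` (integral gain × grid inductance × active current reference). -/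
theorem dimD_pos_iff (hμ : 0 < L.loopFactor B) (hσ : 0 < L.sigma B) :
    0 < L.dimD B ↔ 0 < L.ki * B.Lg * B.igd := by
  unfold dimD
  rw [div_pos_iff_of_pos_right (mul_pos hμ hσ)]

/-- **DICTIONARY THEOREM.** For `μ = 1 − k^p L_g i_d > 0`, `k^i V_e Ω_b > 0`, `V_e ≠ 0`: if `(θ, ε)`
solves the COMPOSED SRF-PLL closed loop, then the rescaled pair
`θ̃(τ) = θ(τ/σ)`, `ω̃(τ) = (Ω_b/σ) · (ω_pll − ω_s)(τ/σ)` is a classical solution of the printed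
dimensionless generalized swing equation `GenSwing ⟨I, D, α⟩` [cite: DuEtAl2024, Eq. (1)] with
`I = (R_g i_q + ω_s L_g i_d)/V_e`, `D = k^i L_g i_d/(μσ)`, `α = k^p V_e Ω_b/(μσ)`, `σ = √(k^i V_e Ω_b/μ)`.
Hence every kernel statement about `GenSwing` solutions (G3.d certificate and -roa, divergence regions,
outer strip) is a statement about the SRF-PLL gains and the grid branch. MODELLED + COMPOSED. -/
theorem isSolution_genSwingOf (hμ : 0 < L.loopFactor B) (hk : 0 < L.ki * B.Ve * L.Ωb)
    (hVe : B.Ve ≠ 0) {θ ε : ℝ → ℝ} (h : L.IsClosedLoopSolution B θ ε) :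
    (L.genSwingOf B).IsSolution (fun τ => θ (τ / L.sigma B))
      (fun τ => L.Ωb / L.sigma B * L.freqMismatch B (θ (τ / L.sigma B)) (ε (τ / L.sigma B))) := by
  have hrad : 0 < L.ki * B.Ve * L.Ωb / L.loopFactor B := div_pos hk hμ
  have hσ : 0 < L.sigma B := L.sigma_pos B hrad
  have hσ2 := L.sigma_sq B hrad
  have hμ0 : L.loopFactor B ≠ 0 := hμ.ne'
  set σ := L.sigma B with hσdef
  have hs : ∀ τ : ℝ, HasDerivAt (fun s => s / σ) (1 / σ) τ := fun τ => (hasDerivAt_id τ).div_const σ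
  refine ⟨fun τ => ?_, fun τ => ?_⟩
  · -- angle: d/dτ θ(τ/σ) = θ'(τ/σ)/σ = Ω_b x/σ
    have hθ := (L.hasDerivAt_angle B h (τ / σ)).comp τ (hs τ)
    have he : L.Ωb * L.freqMismatch B (θ (τ / σ)) (ε (τ / σ)) * (1 / σ)
        = (L.genSwingOf B).dθ (θ (τ / σ)) (L.Ωb / σ * L.freqMismatch B (θ (τ / σ)) (ε (τ / σ))) := by
      simp only [GenSwing.dθ]
      ring
    rw [he] at hθ
    exact hθ
  · -- frequency: d/dτ [(Ω_b/σ) x(τ/σ)] = (Ω_b/σ²) ẋ(τ/σ)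
    have hx := ((L.hasDerivAt_freqMismatch B hμ0 h (τ / σ)).comp τ (hs τ)).const_mul (L.Ωb / σ)
    have he : L.Ωb / σ *
          ((L.ki * (B.Rg * B.igq + L.ωs * B.Lg * B.igd - B.Ve * sin (θ (τ / σ)))
            - (L.kp * B.Ve * L.Ωb * cos (θ (τ / σ)) - L.ki * B.Lg * B.igd)
              * L.freqMismatch B (θ (τ / σ)) (ε (τ / σ))) / L.loopFactor B * (1 / σ))
        = (L.genSwingOf B).dω (θ (τ / σ)) (L.Ωb / σ * L.freqMismatch B (θ (τ / σ)) (ε (τ / σ))) := by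
      simp only [GenSwing.dω, genSwingOf, dimI, dimD, dimAlpha]
      rw [← hσdef]
      field_simp
      rw [hσ2]
      field_simp
    rw [he] at hx
    exact hx

/-- Equilibria of the composed closed loop in dictionary form: the mismatch vanishes and
`V_e sin θ* = R_g i_q + ω_s L_g i_d` (i.e. `sin θ* = I`) make both closed-loop right-hand sides zero. -/
theorem closedLoop_rest (hμ : L.loopFactor B ≠ 0) {θ ε : ℝ}
    (hx : L.freqMismatch B θ ε = 0) (hs : B.Ve * sin θ = B.Rg * B.igq + L.ωs * B.Lg * B.igd) :
    L.dθ (L.vqSolved B θ ε) ε = 0 ∧ L.dε (L.vqSolved B θ ε) = 0 := by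
  have hμ' : 1 - L.kp * B.Lg * B.igd ≠ 0 := hμ
  have hω : L.omegaPll (L.vqSolved B θ ε) ε = L.ωs := by
    have := hx; simp only [freqMismatch] at this; linarith
  refine ⟨by simp [dθ, hω], ?_⟩
  -- v_q = −V_e sin θ + R_g i_q + L_g i_d ω_pll = −V_e sin θ + R_g i_q + L_g i_d ω_s = 0
  have hfix := L.vqSolved_fixed B hμ θ ε
  rw [hω] at hfix
  simp only [dε]
  rw [hfix]
  simp only [vgqComposed, veqOf]
  linarith

end SrfPll

end Summit.Ventures.GridStability.Models.InverterPLL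

end
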